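import Summits.AtomisticToContinuum.Crystallization.Theorems.PalmUnimodularRigidityLayeredLawsSelectHcpLocalCongruenceStar
import Mathlib.Data.Fintype.Pi

/-!
# Local congruence ⇒ global congruence, III: neighbours by parity, the shell gap, exact stars
(stub `stub_localCongruence` of line `mtp-prestress-split-ergodic-frame`, crux `LayeredLawsSelectHcp`,
stmt-AtomisticToContinuum-9226; part 3 of 4)

* `nbr v ε`, `twist v`: the twelve touching neighbours of an hcp site `v ∈ ℤ³` are `nbr v ε`,
  `ε ∈ hcpStarIdx` — `v + ε` on even (`A`) layers, `v + (ε₁, −ε₂, −ε₃)` on odd (`B`) layers — and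
  `hcpSite a h (nbr v ε) = hcpSite a h v + twist v (hcpSite a h ε)` for ALL `(a, h)` with `twist v` the
  identity resp. the half-turn (`HcpHomogeneous`): every star of every relaxed hcp is the twisted
  root star (`hcpSite_nbr`), and in the ideal stacking touching IS being a labelled neighbour
  (`dist_ideal_eq_one_iff_nbr`, by counting against `BarlowCoordination.ncard_touching_barlowPos`);
* `dist_le_of_goodShell`: a `(1/100)`-good shell has no points with `101/100 < dist ≤ 9/8`, so the
  chart's bond threshold `28/25` and the star radius `11/10` see the same points;
* **`stub_localCongruenceExactStar`** (registered sub-goal): a vanishing congruence defect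
  `inf_A ∑_v dist(A (hcpSite a h v), Z)² = 0` against a finite non-empty `Z` is ATTAINED by an exact
  labelled copy — some `g : hcpStarIdx → Z` with exactly the mutual distances and lengths of the
  reference struts (finitely many labellings, each with positive total mismatch unless exact; an `A`
  with defect `< ε²` yields a labelling with mismatch `≤ 300 ε`). No compactness of `O(3)` is used.

All `[folklore]`.
-/

noncomputable section

namespace Summit.AtomisticToContinuum.Crystallization.Theorems.PalmUnimodularRigidity.LayeredLawsSelectHcp

open MeasureTheory Set
open Literature.MathematicalPhysics.StatisticalMechanics Literature.Geometry.DiscreteGeometry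

/-! ## Part C — neighbours of a site of either parity, the shell bound, the exact star -/

section Frames

open Summit.AtomisticToContinuum.Crystallization.Theorems.LayeredLawsSelectHcp.Negative.DiracLaws (GoodShell)
open scoped RealInnerProductSpace

/-- Euclidean `3`-space. [folklore] -/
local notation "E3" => EuclideanSpace ℝ (Fin 3)
/-- The ideal hcp sites. [folklore] -/
local notation "Pᵢ" => hcpSite 1 (Real.sqrt (2 / 3))

/-- The neighbour of the site `v` with star label `ε`: `v + ε` on even (`A`) layers, `v + ε*` with
`ε* = (ε₁, −ε₂, −ε₃)` on odd (`B`) layers (whose star is the half-turned `A`-star). [folklore] -/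
def nbr (v ε : ℤ × ℤ × ℤ) : ℤ × ℤ × ℤ :=
  if Even v.1 then (v.1 + ε.1, v.2.1 + ε.2.1, v.2.2 + ε.2.2) else (v.1 + ε.1, v.2.1 - ε.2.1, v.2.2 - ε.2.2)

/-- The frame twist of the site `v`: the identity on even layers, the half-turn about the vertical
axis on odd layers. [folklore] -/
def twist (v : ℤ × ℤ × ℤ) : E3 ≃ₗᵢ[ℝ] E3 :=
  if Even v.1 then LinearIsometryEquiv.refl ℝ E3 else halfTurn

/-- **The star of every site is the twisted root star**: `hcpSite (nbr v ε) = hcpSite v + twist v (hcpSite ε)`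
for ALL spacings `(a, h)` (`hcp_add_of_even`, `hcp_add_halfTurn_of_odd`). [folklore] -/
theorem hcpSite_nbr (a h : ℝ) (v ε : ℤ × ℤ × ℤ) :
    hcpSite a h (nbr v ε) = hcpSite a h v + twist v (hcpSite a h ε) := by
  unfold nbr twist hcpSite
  by_cases hk : Even v.1
  · rw [if_pos hk, if_pos hk, LinearIsometryEquiv.coe_refl, id, hcp_add_of_even a h hk]
  · rw [if_neg hk, if_neg hk, hcp_add_halfTurn_of_odd a h (Int.not_even_iff_odd.1 hk)]

/-- `√(2/3)² = ⅔ · 1²` (the ideal layer spacing at unit in-layer spacing). [folklore] -/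
theorem sqrt_twoThirds_sq : Real.sqrt (2 / 3) ^ 2 = 2 / 3 * 1 ^ 2 := by
  rw [Real.sq_sqrt (by norm_num)]; ring

/-- The struts of the ideal star have length `1`. [folklore] -/
theorem norm_ideal_strut {ε : ℤ × ℤ × ℤ} (hε : ε ∈ hcpStarIdx) : ‖Pᵢ ε‖ = 1 := by
  obtain ⟨m, rfl⟩ := exists_starLab_eq hε
  have h := hcpSite_dist_sq 1 (Real.sqrt (2 / 3)) (starLab m) 0
  rw [hcpSite_zero, dist_zero_right, Real.sq_sqrt (by norm_num : (0 : ℝ) ≤ 2 / 3), one_pow] at h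
  have h1 : ‖Pᵢ (starLab m)‖ ^ 2 = 1 := by
    rcases star_pairs.2 m with hq | hq <;> rw [hq] at h <;> push_cast at h <;> linarith
  exact (pow_eq_one_iff_of_nonneg (norm_nonneg _) two_ne_zero).1 h1

/-- The ideal sites are pairwise distinct (the ideal stacking is a packing). [folklore] -/
theorem hcpSite_ideal_injective : Function.Injective (hcpSite 1 (Real.sqrt (2 / 3))) := by
  rintro ⟨k, i, j⟩ ⟨k', i', j'⟩ h
  by_contra hne
  have h1 := le_dist_barlowPos_of_ideal isHaggSeq_alternating one_pos sqrt_twoThirds_sq hne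
  have h0 : dist (Pᵢ (k, i, j)) (Pᵢ (k', i', j')) = 0 := by rw [h, dist_self]
  unfold hcpSite at h0
  dsimp only at h0
  linarith

/-- **The touching neighbours of a site of the ideal hcp are exactly its twelve labelled neighbours**:
the twelve labelled neighbours touch (`hcpSite_nbr`, unit struts) and are distinct, and a site has
exactly twelve touching sites (`BarlowCoordination.ncard_touching_barlowPos`). [folklore] -/
theorem dist_ideal_eq_one_iff_nbr (v w : ℤ × ℤ × ℤ) :
    dist (Pᵢ v) (Pᵢ w) = 1 ↔ ∃ ε ∈ hcpStarIdx, w = nbr v ε := by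
  have hfwd : ∀ ε ∈ hcpStarIdx, dist (Pᵢ v) (Pᵢ (nbr v ε)) = 1 := fun ε hε => by
    rw [hcpSite_nbr, dist_self_add_right, LinearIsometryEquiv.norm_map, norm_ideal_strut hε]
  refine ⟨fun h => ?_, ?_⟩
  · obtain ⟨k, i, j⟩ := v
    have hcard := ncard_touching_barlowPos isHaggSeq_alternating one_pos sqrt_twoThirds_sq k i j
    have hinjN : Function.Injective fun ε => Pᵢ (nbr (k, i, j) ε) := fun ε ε' hεε' => by
      have h1 : twist (k, i, j) (Pᵢ ε) = twist (k, i, j) (Pᵢ ε') :=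
        add_left_cancel (by rw [← hcpSite_nbr, ← hcpSite_nbr]; exact hεε')
      exact hcpSite_ideal_injective ((twist (k, i, j)).injective h1)
    have hsub : (fun ε => Pᵢ (nbr (k, i, j) ε)) '' ↑hcpStarIdx ⊆
        {p : E3 | p ∈ barlowStacking 1 (Real.sqrt (2 / 3)) alternatingHagg ∧
          dist (barlowPos 1 (Real.sqrt (2 / 3)) alternatingHagg k i j) p = 1} := by
      rintro _ ⟨ε, hε, rfl⟩
      exact ⟨barlowPos_mem _ _ _, hfwd ε hε⟩
    have hImg : ((fun ε => Pᵢ (nbr (k, i, j) ε)) '' ↑hcpStarIdx).ncard = 12 := by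
      rw [Set.ncard_image_of_injective _ hinjN, Set.ncard_coe_finset, card_hcpStarIdx]
    have heq := Set.eq_of_subset_of_ncard_le hsub (by rw [hcard, hImg])
      (Set.finite_of_ncard_pos (by rw [hcard]; norm_num))
    have hw : Pᵢ w ∈ {p : E3 | p ∈ barlowStacking 1 (Real.sqrt (2 / 3)) alternatingHagg ∧
        dist (barlowPos 1 (Real.sqrt (2 / 3)) alternatingHagg k i j) p = 1} := ⟨barlowPos_mem _ _ _, h⟩
    rw [← heq] at hw
    obtain ⟨ε, hε, hεw⟩ := hw
    exact ⟨ε, hε, (hcpSite_ideal_injective hεw).symm⟩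
  · rintro ⟨ε, hε, rfl⟩
    exact hfwd ε hε

/-- **A `(1/100)`-good shell has no points in the gap**: a point of `S` within `9/8` of a good point
`x` is within `101/100` of it (it is matched within `a/100` to a rotated `a`-scaled unit pattern,
`a ≤ 1`). [folklore] -/
theorem dist_le_of_goodShell {S : Set E3} {x y : E3} (h : GoodShell S x) (hy : y ∈ S) (hne : y ≠ x)
    (hd : dist y x ≤ 9 / 8) : dist y x ≤ 101 / 100 := by
  obtain ⟨a, h9, h1, T, hT, hclose⟩ := h
  have hmem : y - x ∈ (↑T : Set E3) := by rw [hT]; exact ⟨y, ⟨hy, hne, by linarith⟩, rfl⟩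
  have key : ∀ P : Finset E3, (∀ q ∈ P, ‖q‖ = 1) →
      ShellCloseTo (a / 100) T (P.image fun v : E3 => a • v) → dist y x ≤ 101 / 100 := by
    rintro P hP ⟨A, e, he⟩
    have ht := he ⟨y - x, hmem⟩
    obtain ⟨p', hp', hq⟩ := Finset.mem_image.1 (e ⟨y - x, hmem⟩).2
    obtain ⟨q, hq0, rfl⟩ := Finset.mem_image.1 hp'
    have hnorm : ‖(e ⟨y - x, hmem⟩ : E3)‖ = a := by
      rw [← hq, LinearIsometry.norm_map, norm_smul, hP q hq0, mul_one, Real.norm_of_nonneg (by linarith)]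
    rw [dist_eq_norm]
    calc ‖y - x‖ ≤ ‖(e ⟨y - x, hmem⟩ : E3)‖ + ‖y - x - (e ⟨y - x, hmem⟩ : E3)‖ := norm_le_insert' _ _
      _ ≤ a + a / 100 := by rw [hnorm, ← dist_eq_norm]; linarith
      _ ≤ 101 / 100 := by linarith
  rcases hclose with hc | hc
  · exact key _ (fun q hq => norm_eq_one_of_mem_fccKissingPattern hq) hc
  · exact key _ (fun q hq => norm_eq_one_of_mem_hcpKissingPattern hq) hc

/-- Equal lengths and equal distance give equal inner products (polarization). [folklore] -/
theorem inner_eq_of_norm_eq_of_dist_eq {x y x' y' : E3} (hx : ‖x‖ = ‖x'‖) (hy : ‖y‖ = ‖y'‖)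
    (hd : dist x y = dist x' y') : ⟪x, y⟫ = ⟪x', y'⟫ := by
  rw [real_inner_eq_norm_mul_self_add_norm_mul_self_sub_norm_sub_mul_self_div_two,
    real_inner_eq_norm_mul_self_add_norm_mul_self_sub_norm_sub_mul_self_div_two, hx, hy,
    ← dist_eq_norm, ← dist_eq_norm, hd]

/-- **Registered sub-goal `stub_localCongruenceExactStar`: a vanishing congruence defect against a
finite non-empty star is attained by an exact labelled copy.** If
`inf_A ∑_{v ∈ hcpStarIdx} dist(A (hcpSite a h v), Z)² = 0` for a finite non-empty `Z`, then some
labelling `g : hcpStarIdx → Z` has exactly the mutual distances and lengths of the reference struts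
(finitely many labellings, each with a positive total mismatch unless exact; an `A` with defect
`< ε²` produces a labelling with mismatch `< 300 ε`). [folklore] -/
theorem stub_localCongruenceExactStar : ∀ a h : ℝ, ∀ Z : Finset E3, Z.Nonempty → (⨅ A : E3 ≃ₗᵢ[ℝ] E3, ∑ v ∈ hcpStarIdx, Metric.infDist (A (hcpSite a h v)) ↑Z ^ 2) = 0 → ∃ g : ℤ × ℤ × ℤ → E3, (∀ v ∈ hcpStarIdx, g v ∈ Z) ∧ (∀ v ∈ hcpStarIdx, ‖g v‖ = ‖hcpSite a h v‖) ∧ ∀ v ∈ hcpStarIdx, ∀ w ∈ hcpStarIdx, dist (g v) (g w) = dist (hcpSite a h v) (hcpSite a h w) := by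
  intro a h Z hZ h0
  by_contra H
  -- the total mismatch of a labelling by star points
  set y : ℤ × ℤ × ℤ → E3 := hcpSite a h with hy
  set M : (↥hcpStarIdx → E3) → ℝ := fun g =>
    (∑ v, ∑ w, |dist (g v) (g w) - dist (y v) (y w)|) + ∑ v, |‖g v‖ - ‖y v‖| with hM
  set G : Finset (↥hcpStarIdx → E3) := Fintype.piFinset fun _ => Z with hG
  have hGne : G.Nonempty := by
    obtain ⟨z, hz⟩ := hZ
    exact ⟨fun _ => z, Fintype.mem_piFinset.2 fun _ => hz⟩
  have hMpos : ∀ g ∈ G, 0 < M g := by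
    intro g hg
    rw [hG, Fintype.mem_piFinset] at hg
    by_contra hle
    have hM0 : M g = 0 := le_antisymm (not_lt.1 hle) (by positivity)
    have hs1 : ∀ v, ∑ w, |dist (g v) (g w) - dist (y v) (y w)| = 0 ∧ |‖g v‖ - ‖y v‖| = 0 := by
      have hA : (∑ v, ∑ w, |dist (g v) (g w) - dist (y v) (y w)|) = 0 ∧ (∑ v, |‖g v‖ - ‖y v‖|) = 0 :=
        (add_eq_zero_iff_of_nonneg (by positivity) (by positivity)).1 hM0
      intro v
      exact ⟨(Finset.sum_eq_zero_iff_of_nonneg fun _ _ => by positivity).1 hA.1 v (Finset.mem_univ v),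
        (Finset.sum_eq_zero_iff_of_nonneg fun _ _ => by positivity).1 hA.2 v (Finset.mem_univ v)⟩
    have hs2 : ∀ v w, |dist (g v) (g w) - dist (y v) (y w)| = 0 := fun v w =>
      (Finset.sum_eq_zero_iff_of_nonneg fun _ _ => by positivity).1 (hs1 v).1 w (Finset.mem_univ w)
    refine H ⟨fun v => if hv : v ∈ hcpStarIdx then g ⟨v, hv⟩ else 0, fun v hv => ?_, fun v hv => ?_,
      fun v hv w hw => ?_⟩
    · dsimp only; rw [dif_pos hv]; exact hg ⟨v, hv⟩
    · dsimp only; rw [dif_pos hv]; exact eq_of_abs_sub_eq_zero (hs1 ⟨v, hv⟩).2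
    · dsimp only; rw [dif_pos hv, dif_pos hw]; exact eq_of_abs_sub_eq_zero (hs2 ⟨v, hv⟩ ⟨w, hw⟩)
  have hμ : 0 < G.inf' hGne M := (Finset.lt_inf'_iff hGne).2 hMpos
  set ε : ℝ := G.inf' hGne M / 600 with hε
  have hε0 : 0 < ε := by positivity
  haveI : Nonempty (E3 ≃ₗᵢ[ℝ] E3) := ⟨LinearIsometryEquiv.refl ℝ E3⟩
  have hlt : (⨅ A : E3 ≃ₗᵢ[ℝ] E3, ∑ v ∈ hcpStarIdx, Metric.infDist (A (hcpSite a h v)) ↑Z ^ 2) < ε ^ 2 := by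
    rw [h0]; positivity
  obtain ⟨A, hA⟩ := exists_lt_of_ciInf_lt hlt
  -- every reference strut has a star point within `ε`
  have hnear : ∀ v ∈ hcpStarIdx, ∃ z ∈ Z, dist (A (y v)) z < ε := by
    intro v hv
    have hle : Metric.infDist (A (y v)) ↑Z ^ 2 ≤
        ∑ w ∈ hcpStarIdx, Metric.infDist (A (hcpSite a h w)) ↑Z ^ 2 :=
      Finset.single_le_sum (f := fun w => Metric.infDist (A (hcpSite a h w)) ↑Z ^ 2)
        (fun w _ => sq_nonneg _) hv
    have hlt' : Metric.infDist (A (y v)) ↑Z < ε :=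
      lt_of_pow_lt_pow_left₀ 2 hε0.le (hle.trans_lt hA)
    obtain ⟨z, hz, hd⟩ := (Metric.infDist_lt_iff (Finset.coe_nonempty.2 hZ)).1 hlt'
    exact ⟨z, hz, hd⟩
  choose! gz hgZ hgd using hnear
  set g : ↥hcpStarIdx → E3 := fun v => gz v with hgdef
  have hgG : g ∈ G := by rw [hG, Fintype.mem_piFinset]; exact fun v => hgZ v v.2
  have hle : G.inf' hGne M ≤ M g := Finset.inf'_le M hgG
  -- but the mismatch of `g` is `≤ 300 ε`
  have ht1 : ∀ v w : ↥hcpStarIdx, |dist (g v) (g w) - dist (y v) (y w)| ≤ 2 * ε := by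
    intro v w
    have hv := hgd v v.2
    have hw := hgd w w.2
    rw [← A.dist_map (y v) (y w)]
    calc |dist (g v) (g w) - dist (A (y v)) (A (y w))|
        ≤ |dist (g v) (g w) - dist (A (y v)) (g w)| + |dist (A (y v)) (g w) - dist (A (y v)) (A (y w))| :=
          abs_sub_le _ _ _
      _ ≤ dist (g v) (A (y v)) + dist (g w) (A (y w)) := by
          gcongr
          · exact abs_dist_sub_le _ _ _
          · rw [dist_comm (A (y v)) (g w), dist_comm (A (y v)) (A (y w))]; exact abs_dist_sub_le _ _ _
      _ ≤ 2 * ε := by rw [dist_comm] at hv hw; simp only [hgdef]; linarith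
  have ht2 : ∀ v : ↥hcpStarIdx, |‖g v‖ - ‖y v‖| ≤ ε := by
    intro v
    have hv := hgd v v.2
    rw [← A.norm_map (y v)]
    calc |‖g v‖ - ‖A (y v)‖| ≤ ‖g v - A (y v)‖ := abs_norm_sub_norm_le _ _
      _ ≤ ε := by rw [← dist_eq_norm, dist_comm]; exact hv.le
  have hcard : (Finset.univ : Finset ↥hcpStarIdx).card = 12 := by simp [card_hcpStarIdx]
  have hMg : M g ≤ 12 * (12 * (2 * ε)) + 12 * ε := by
    apply add_le_add
    · calc (∑ v, ∑ w, |dist (g v) (g w) - dist (y v) (y w)|) ≤ ∑ _v : ↥hcpStarIdx, ∑ _w : ↥hcpStarIdx, 2 * ε :=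
            Finset.sum_le_sum fun v _ => Finset.sum_le_sum fun w _ => ht1 v w
        _ = 12 * (12 * (2 * ε)) := by simp only [Finset.sum_const, hcard, nsmul_eq_mul]; push_cast; ring
    · calc (∑ v, |‖g v‖ - ‖y v‖|) ≤ ∑ _v : ↥hcpStarIdx, ε := Finset.sum_le_sum fun v _ => ht2 v
        _ = 12 * ε := by simp only [Finset.sum_const, hcard, nsmul_eq_mul]; push_cast; ring
  have : G.inf' hGne M ≤ 300 * ε := hle.trans (by linarith)
  rw [hε] at this
  linarith

end Frames

end Summit.AtomisticToContinuum.Crystallization.Theorems.PalmUnimodularRigidity.LayeredLawsSelectHcp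

end
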